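import Literature.MathematicalPhysics.QuantumFieldTheory.Balaban1983to89.B13Resummation
import Literature.MathematicalPhysics.QuantumFieldTheory.Balaban1983to89.B13Bound143OneShot

/-!
# `Balaban1983to89.B13Carve29Sect2ClusterHyp` — [Balaban1988RG2Cluster] pp. 11–17 (Sect. 2, part 1: (2.1)–(2.26) — the
# Mayer expansion (2.1)–(2.4), conditioning and change of variables (2.5)–(2.6), the square root (2.7), the decoupling
# (2.8)–(2.10), the polymer expansion and its exponentiation (2.11)–(2.13), the analyticity statement p. 15, and the bound
# (2.14)–(2.26) of ONE term of the activity `H(Z)`): P6 CARVING-FAN BLOCK 29 — the block's residual printed sentences in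
# hypothesis form and ONE hypothesis bundle `Hyp` of the section's printed statements BY NAME, keyed to the consumer
# (`stmt-QuantumFields-20543`, K2⁷ `EndpointGivenBR13SepCoPH`; DAG node [B13] = the leaf
# `B13.Lemma1Printed ∧ Lemma2Printed ∧ Lemma3Printed` of `DagBinding.Upstream.ofPrinted`; also-feeds 20544)

statement-level skeleton of published theorems with citation tags; proofs where landed; nothing here is a claim about the
Yang–Mills mass gap

T. Bałaban, *Renormalization group approach to lattice gauge field theories. II. Cluster expansions*, Commun. Math. Phys.
**116** (1988) 1–22, doi:10.1007/bf01239022 `[Balaban1988RG2Cluster]` (cell paper "B13" = «[II]» of the later papers;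
journal page = PDF page).  STATUS: published, refereed.  PDF held: `paper:balaban1988-cmp116-rg-ii-cluster`; pp. 11–17
read by this seat AS IMAGES (renders `run/shared/lean/pub/pub-balaban/b2b-balaban-ref1/pages/1988-cmp116-rg-II-cluster/
…-p012-x2.png` … `-p017-x2.png`, 2026-08-28) and on the text layer (`p0011.txt` … `p0017.txt`, line locators below).
References of [II] are those of [I] = [Balaban1987RG1] (`B13` header): [6] = [Balaban1983Higgs2], [13] =
[Balaban1985BackgroundPropagators] (B9), [16] = [Balaban1985UV3] (B10), [26] = Cammarota CMP 85 (1982), [36, 60, 25, 67, 50]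
= Gallavotti–Martin-Löf–Miracle-Solé, Kunz–Souillard, Brydges, Seiler, Glimm–Jaffe (the exponentiation formula (2.12)).

CITATION HEADER (lean-in-tree rule).  Cell `lit-balaban` (HOME `run/shared/lean/pub/lit-balaban/`), P6 CARVING FAN
(D-0154 (3b)), block 29 of `carve/BLOCKS-21-30.md` (lead g30, READY 2026-08-28T05:30Z) = `carve/CARVE-LIST.md` § Block 29,
claimed by seat `carve-10` g4 under RULING #8 (`carve/STATUS.md` 07:30:58Z / CLAIM 07:33:27Z): «[B13] pp. 11–17, Sect. 2
part 1: final localization by a cluster expansion (2.1)–(2.26) (Mayer∕polymer expansion, analyticity (2.13)); 29 SKELETON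
rows; KEY stmt-QuantumFields-20543, also-feeds 20544; target this file».  Filed `--supports stmt-QuantumFields-20543`.
RULES (`carve/CARVE-RULES.md` §2): IN TREE = CITE, NEVER RESTATE; residual printed statements in hypothesis form
`def …Printed : Prop`; ONE bundle `Hyp`; no `instance`, no `notation`, 0 `sorry`.

## WHAT THE BLOCK'S PAGES PRINT AND WHERE THE TREE HOLDS IT (cite table — every SKELETON row of the block is IN TREE;
## nothing in this table is restated below)
* row B13.Eq2.1 — (2.1) p. 12, the Mayer expansion of the action density: `B13MayerDecoupling.mayer_expansion_21` (PROVED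
  over the abstract algebra of `t(Y)`-interpolations; the decoupling identity (1.9)/(1.10) behind it: `decoupling_19`).
* row B13.Def2.2 — (2.2) `Y₀ = ∪_{Y∈𝐃} Y` and the bond set `Y₀^{c*} = {b ∈ T^{(k)} : b ⊂ Y₀ᶜ}∖{b₀(c) : c ∈ T^{(k+1)}}`:
  `B13CorridorSeparation.corr` and `B13FamilySum.coveringFamilies` (the families 𝐃 with ∪𝐃 = Y₀).
* row B13.Eq2.3 — (2.3) `χ_k = Σ_{P⊂Y₀^{c*}} (−1)^{|P|} χ_{k,Y₀} χᶜ_{k,P}`: `B13MayerDecoupling.charFn_decomposition_23` (PROVED).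
* row B13.Def2.4 — p. 12 «For a given set P we take the smallest localization domain Z₀ ∈ 𝐃_k containing Y₀ and P. Let us
  stress that bonds of P have to be contained in the interior of Z₀, they cannot intersect the boundary ∂Z₀» and (2.4)
  `(2.1) = Σ_{Z₀∈𝐃_k} ∫dμ_{C^{(k)}}(B)F(Z₀, B)`: `B13Factor210.Hsum` / `admMeets` (the resummation bookkeeping over Z₀) and
  `B13Lemma3Assembly.admP` (the admissible P: «bonds of P … in the interior of Z₀», read with p. 18).
* row B13.Eq2.5 — (2.5) p. 12, conditioning on Z₀ᶜ («in a similar way to (2.28) [6]»): `B13GaugeDevices.display_25`,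
  `ratio_25` (PROVED in the finite-dimensional conditioning model, `B13GaugeDevices` §H).
* row B13.Def2.6 — (2.6) pp. 12–13, «B′ = (C^{(k)})^{1/2}X … where the last equality is a definition of the function G, and
  the measure dμ₀»: `B13Sect2Statements.G26`, `display_26` (PROVED), `B13GaugeDevices.gaussMean_whiten`.
* p. 13 ll. 4–24 (the choice of the LM-cubes σ₀, the domains Z̃₀, Z′₀, X₀ with X̃₀⁵ = Z̃₀, «dist(X, Z₀) > ⅔M», «This
  construction was discussed in [13] for all operators determining Δ_k, and for C^{(k)}(Z₀), but not for (C^{(k)})^{1/2}»):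
  set-up prose; the random-walk expansions of [13] are the by-reference inputs recorded in `B13`'s header (cell GAPS.md
  G-B13-*) and consumed as named hypotheses by `B13Lemma3TorusPrimitive` / `B13PrimitiveKernels216.Localisation17a`.
* row B13.Eq2.7 — (2.7) p. 13, `(C^{(k)})^{1/2} = (C*Δ_kC)^{−1/2} = (1/π)∫₀^∞ dx x^{−1/2}(xI + C*Δ_kC)^{−1} = (1/π)∫₀^{γ₁} … +
  Σ_{n≥0} ((−1)ⁿ/(n + ½)π) γ₁^{−n−1/2}(C*Δ_kC)ⁿ` and «we obtain an expansion of the series above, if γ₁ is sufficiently large»: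
  `B13Sqrt27` (the scalar identity, `integral_kernel_Ioi`, and the operator form under a form bound — "γ₁ sufficiently
  large" = γ₁ above the spectrum, PROVED), `B13Sqrt27Accretive`, `B13Sqrt27AccretiveAlmostLocal`, `B13Sqrt27AccretiveSquare`
  (the almost-local accretive version); row B13.Eq2.7rw — the resolvent representation «the operator C(xI + C*Δ_kC)^{−1}C*
  is representated by the integral (3.185) [13] with the additional term −½x‖χ*(QA + D̃μ(QA))‖² … This term determines a
  nonnegative, bounded and almost local operator … The operator G̃₃(x) has the same properties as G̃₂, especially it can be
  expanded into a generalized random walk expansion»: `B13Resolvent27.resolvent_rep_27` (PROVED for the abstract resolvent)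
  and the header of `B13Sqrt27AccretiveAlmostLocal` (the G̃₃(x)-claim is BY REFERENCE to [13] (3.185) = the tree's
  `B9.Thm315Printed` ff.; no body, no constant ⇒ not typed here, as the block-10 referee ruled for by-reference claims,
  `carve/CHECK-5.md` N-c5-6).
* row B13.Eq2.8 — (2.8) p. 14 and «The sums are over Z such, that each connected component of Z contains a component of
  Z′₀»: `B13Sect2Statements.display_28`, `H28`, `display_28_restricted` (PROVED modulo the by-reference locality).
* rows B13.Eq2.9, B13.Eq2.10 — (2.9) `(2.1) = Σ_Z H(Z), H(Z) = Σ_{Z₀ : Z̃₀⊂Z} H(Z, Z₀)` and (2.10) `H(Z) = H(Z₁)⋯H(Z_n)`: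
  `B13Factor210.Hsum`, `Hsum_union`, `Hsum_biUnion` (PROVED), `B13Eq210Components`, `B13Factor210Literal`; the abstract
  activity is the field `B13.StepData.H`.
* row B13.Eq2.11 — (2.11) p. 14, the polymer expansion with the hard core ζ: `B13Sect2Statements.polymerExpansion_211`
  (PROVED), the polymer geometry `B13Resummation.Geometry` (ζ as the incompatibility `ι`).
* row B13.Def2.12 — (2.12) p. 14 «If the activities H(Z) … are sufficiently small, then the polymer expansion can be
  exponentiated according to the well-known formula, see [36, 60, 26, 25, 67, 50]», ρ^T, C_n: `B13MayerDecoupling.connGraphs`,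
  `ursellSeries212`; the exponentiation itself PROVED in Kotecký–Preiss form: `B13Resummation.kp_condition`,
  `exp_sum_locE_eq_Z` (tree engine `Literature.Probability.LatticeModels.ClusterExpansionKPBound`), `B13UrsellKPSeries`.
* row B13.Def2.13 — (2.13) p. 14 `E^{(k+1)}(X) = Σ_{n≥1}(1/n!)Σ_{(Z₁,…,Z_n): ∪Z_i = X} ρ^T(Z₁,…,Z_n)H(Z₁)⋯H(Z_n), X ∈ 𝐃_{k+1}`:
  `B13MayerDecoupling.ursellSeries213` (printed form), `B13Resummation.locE` / `Repr213` (Kotecký–Preiss form, the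
  definition of the abstract `B13.StepData.Ek1`) — `Repr213` is a member of the bundle below, BY NAME.
* p. 14 «To end the proof of the first part of Theorem 3 we have to prove the bounds (I.1.18)»: `B13.Bound118`,
  `B13.Bound241`, `B13.CammarotaStep` ((2.38) ⇒ (2.41), DISCHARGED in the kernel by `B13Resummation.cammarotaStep_of_KP`).
* row B13.Eq2.13an — p. 15 ll. 2–11, the analyticity passage: «They [the potentials V_k(Y, B)] can be extended to functions
  of (𝐔, 𝐉), analytic on the space Uᶜ_{k+1}(Y, (1 + β)α₀, (1 + β)α₁, α₀)» = Lemma 2's clause `B13.Lemma2Printed` (first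
  conjunct, on `StepData.sp1`); «Of course Y ⊂ Z₀, and Z̃₀ ⊂ Z ⊂ X … The quadratic forms and covariances in H(Z) are analytic
  functions on the space of configurations (𝐔, 𝐉) satisfying the conditions I.(i)–(iii) on the domain Z, with constants α′₀,
  α′₁ much bigger than α₀, α₁, therefore we can restrict them, as analytic functions, to the above subspace»:
  `B13Resummation.SpRestr` (the restriction property of the spaces `StepData.sp2`, a member of the bundle below BY NAME) and,
  on the torus model, `B13ExpansionAnalytic`, `B13PrimitiveKernels216.localisation17a_of_majorants` /
  `differences216_of_analytic`, `B13RealSliceEntryLetters`.  The two remaining sentences of the passage («The potentials are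
  also analytic functions on the subspace Uᶜ_{k+1}(X, α₀, α₁)»; «Thus the activities in (2.13), and the whole sum E^{(k+1)}(X),
  are analytic functions of (𝐔, 𝐉), on the space Uᶜ_{k+1}(X, α₀, α₁). This is the analyticity statement in the inductive
  assumptions») had no declaration (the tree consumes the conclusion as the bare hypothesis `han` of
  `B13.deliverables_of_chain`, for `StepData.Etot`): typed below (§1, `PotentialsRestrictPrinted`, `Analytic213Printed`).
* row B13.Eq2.14 — (2.14) p. 15, the generic term with the s-, t-Cauchy integrals and `Γ_k(Z₀, σ(Z)) =
  C*Δ_k(σ(Z))CZ₀ᶜ(C^{(k)})^{1/2}(σ(Z))`, «We consider it as an analytic function of (𝐔, 𝐉) … and of the complex parameters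
  σ(Z), τ»: `B13Term214.term214`, `core214`, `cauchyD_eq_deriv` (PROVED), `B13Sect2Statements.gamma26`,
  `B13Representation214.H28_sum_eq_sum_term214`, `B13Integral223.norm_F214_le`.
* p. 15 «by the definition of the space, the configuration 𝐔 can be written as 𝐔 = U′U, U′ = exp iL⁻¹ηA′, and A′, 𝐉 have
  values in 𝔤ᶜ, but they are small. More precisely we have |A″|, |∇_U^{L⁻¹η}A′| < α₁, |𝐉| < α₀. For the pair (U, 0) the
  operators are symmetric, and the measure is positive … The general case is handled by a perturbative argument»: the
  spaces (I.1.13)/(I.1.14) are `StepData.sp2` (abstract) and the B12 space vocabulary; the symmetric case and the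
  perturbative argument are `B13Integral223` §7 (`norm_innerMean_le`, `norm_outerMean_le`) and `B13PerturbativeStep`.
* row B13.Eq2.15 — (2.15) p. 15 (print «|(7.14)|» = |(2.14)|), the first estimate: `B13PerturbativeStep.norm_cexp_neg_half_quadForm`,
  `B13FirstEstimate215`, `B13FirstEstimate215Assembled` (PROVED).
* row B13.Eq2.16 — (2.16) p. 16 «½⟨X, R₁X⟩, with matrix elements satisfying the bound |R₁(b, b′)| ≦ (O(1)e^{−1/3δ₀M} +
  O(α₀ + α₁))exp(−½δ₀|b₋ − b′₋|)», and p. 16 ll. 9–13 «exp½⟨B, R₂B⟩ with R₂ satisfying (2.16) … a bilinear from −⟨B, R₃X⟩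
  with R₃ satisfying (2.16)»: BY ASSERTION in print (cell GAPS.md G-B13-07); the tree's mechanism is the weighted-row-sum
  algebra `B13PerturbativeStep.WRS` (`WRS.of_entrywise`, `WRS.inv_add_sub_inv`), the torus derivation of R₁'s bound from
  primitive kernel bounds `B13Eq216FirstForm.h216R1_of_factors` / `h216R1_uniform`, the primitive inputs BY NAME
  `B13PrimitiveKernels216.Differences216` / `Localisation17a`, `B13CovarianceDifference216.hdC_of_hdE`, and the consumers
  `B13Replacement223`, `B13Bound226From216.norm_term214_le_226_of_216`.  The SKELETON decl cell of this row did not resolve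
  to a statement-level declaration (CARVE-LIST § Block 29: «cite UNRESOLVED»): the DISPLAY ITSELF, for the three kernels R₁,
  R₂, R₃ over explicit carriers, is typed below (§1, `Bound216Printed`).
* p. 16 ll. 4–5 «We have assumed, as in Sect. 1, that M is much bigger than κ₁, especially that e^{−1/3δ₀M}e^{16κ₁} < 1»
  (cell census R11 of `pub-balaban/b2b-balaban-b13/transcript-B13.md`; quoted in the headers of `B13PerturbativeStep`,
  `B13SigmaThroughWalks`, no declaration): typed below (§1, `Restr216MPrinted`).
* row B13.Eq2.17 — (2.17) «The determinants in the next factor are equal for the new operators, hence this factor can be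
  estimated by exp((O(1)e^{−1/3δ₀M} + O(α₀ + α₁))|Z₀|)»: `B13PerturbativeStep.norm_det_one_add_le_exp` (PROVED).
* row B13.Eq2.18 — (2.18) `1/|τ(Y)| = E₀ε₁C₁α₄⁻¹M^q exp C₂κ₁ exp(−(1 − 3δ)κd_k(Y))` and «We take a small, positive number
  α₄, to be chosen later»: `B13Bound143.invTau`, `invTau_pos`; p. 16 «We assume that ⅛(κ₁ − 1) ≧ (1 − 3δ)κ, C₃ ≦ E₀C₁, and
  q ≧ 8»: `B13Bound143.R12` (typed VERBATIM, three clauses; a member of the bundle below BY NAME), `R25_of_R12`.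
* rows B13.Eq2.19, B13.G6 — (2.19) and the geometric input behind it: `B13Bound143.elem219`, `elem219_of_bound143`,
  `rhs143_le_invTau_mul_elem219` (PROVED from (1.43) + R12), `B13DiameterG6.l1_le_card_sub_one` (PROVED).
* row B13.Eq2.20 — (2.20) and p. 16 ll. 20–24 «The sum of these quadratic forms over Y ∈ 𝐃 is bounded by a quadratic form
  with the above matrix elements resummed over all Y ∈ 𝐃_k containing, for example, the point b₋ … this yields a constant
  O(1). In fact the constant is small for κ₁ large, hence we can bound it by 1. Using (1.28) we obtain (2.20)»:
  `B13Resum220.resum_quadForm` (CERTIFIED with a = ¼(κ₁ − 1)), `B13Ineq220Torus`, `B13Bound226CentredUnscaled` (PROVED).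
* row B13.Eq2.21 — (2.21): `B13PerturbativeStep.norm_bilinForm_le`, `B13Replacement223` (PROVED).
* row B13.Eq2.22 — (2.22) and «where γ₂ is a small, positive constant»: `B13.indicator_le_exp_222` (PROVED, `0 ≤ γ₂`);
  the positivity of α₄ and γ₂ as printed constants clauses: typed below (§1, `SmallPositive16Printed`).
* row B13.Def2.23 — (2.23) p. 17 and «where α₅ = O(1)e^{−1/3δ₀M} + O(α₀ + α₁) + O(1)α₄ + γ₂. It is a Gaussian integral, and
  can be easily calculated»: `B13Integral223.integral223`, `innerB` (the printed objects), `B13Replacement223` ((2.15) ⇒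
  (2.23)); the composition of α₅ is consumed located (`B13Bound226Numerals.alpha5_mul_dSum_le`, binders `hαc`/`hsmall` of
  the tower) but had no statement-level declaration over `B13.Consts` (whose field `α₅` is free): typed below (§1,
  `Alpha5Printed`).
* row B13.Eq2.24 — (2.24) and p. 17 «Of course we have assumed that α₅ is sufficiently small, e.g. α₅‖C^{(k)}(Z₀, 0)‖ < ½.
  The factor with the determinants can be estimated by exp O(1)α₅|Z₀|. The quadratic form under the exponential is expanded
  with respect to α₅, and the zeroth order term cancels the first quadratic form under the first exponential in (2.23). The
  remainder can be estimated by ½O(α₅)‖ZX‖²»: `B13Integral223.innerB_eq_224` (PROVED, exact), `posDef_inv_sub_smul` (what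
  «α₅ sufficiently small» buys), `sqrt_det_ratio_le` (the determinant factor), `form_224_le` (the remainder), `integral223_eq`
  (the cancellation); the smallness clause itself (cell census R14) had no declaration: typed below (§1, `Restr224Printed`).
* row B13.Eq2.25 — (2.25): `B13Integral223.outer_225_eq`, `outer_225_le` (PROVED, `0 ≤ a ≤ ½`).
* row B13.Eq2.26 — (2.26) p. 17 «|(2.14)| ≦ exp(−(κ₁ − 1)(LM)⁻⁴|Z∖Z′₀|)[Π_{Y∈𝐃} 2E₀ε₁C₁α₄⁻¹M^q exp C₂κ₁ exp(−(1 − 3δ)κd_k(Y))]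
  exp(−½γ₂(ε₁²/g_k²)|P|) · exp O(1)α₅|Z|»: `B13Integral223.integral223_le_226`, `B13Bound226From216.norm_term214_le_226_of_216`,
  `B13Bound226Assembly`, `B13Bound226Witness*`, `B13Lemma3TorusPrimitive.h226_torus_of_primitives` (PROVED on the torus model
  from the primitive kernel hypotheses), the per-term hypothesis shapes `B13Lemma3TorusSocket.TermDomination` /
  `Termwise226`, and the (2.26)-weights `B13Lemma3Assembly.innerSum` entering the resummation pp. 17–20 (block 30:
  `bound238With_of_226` ⇒ Lemma 3 `B13.Lemma3Printed`).  p. 17 «As we have remarked already it is possible to get a better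
  bound, e.g. with |Z₀| instead of |Z| in the last exponential»: a remark, no statement.
* The resummation order paragraph of p. 17 (after (2.26)) opens pp. 17–20 = block 30 (`B13Lemma3Assembly` header quotes it).

## WHAT THIS FILE ADDS
§1 SEVEN RESIDUAL PRINTED SENTENCES with no statement-level declaration of record (searched 2026-08-28: `rg` over
`Balaban1983to89/B13*.lean` for the printed constants and phrases; hits only inside docstrings / as located binders, listed
row by row above), typed in hypothesis form in the schematic currency of `B13.StepData` / `B13.Consts` (the carrier and the
constants record of `B13.Lemma1Printed`–`Lemma3Printed`, i.e. of the DAG leaf) or over explicit carriers, each with a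
kernel-checked companion: `HLocalizedPrinted` (p. 14), `PotentialsRestrictPrinted` and `Analytic213Printed` (p. 15),
`Bound216Printed` ((2.16) for R₁, R₂, R₃, p. 16), `Restr216MPrinted` (p. 16, census R11), `SmallPositive16Printed` (p. 16),
`Alpha5Printed` (p. 17), `Restr224Printed` (p. 17, census R14).
§2 THE BUNDLE.  `Carriers S` — the parameters these sentences take beyond the step carrier `S : B13.StepData`, the constants
`c : B13.Consts` and the polymer geometry `G : B13Resummation.Geometry S.Dk1 Cube` (plain data, no instances); `Hyp S c G X`
— the block's printed STATEMENTS as hypotheses BY NAME: the §1 sentences and the in-tree typed statements of pp. 14–16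
(`B13Resummation.Repr213` (2.13), `B13Resummation.SpRestr` p. 15, `B13Bound143.R12` p. 16); the PROVED rows enter nothing
(they are theorems of the tree, cited above).  Bookkeeping theorems: `Hyp.cammarotaStep` (the bundle's `repr213` ∕ `spRestr`
ARE the two structural inputs of the tree's discharge `B13Resummation.cammarotaStep_of_KP` of the [26]-step (2.38) ⇒ (2.41)),
`Hyp.deliverables` (with Lemma 3, the closing restrictions of p. 21 and the log-half, the bundle feeds `B13.deliverables_of_chain`
— the clauses [II] delivers to the K2⁷ consumer's leaf), `Hyp.posDef224` / `Hyp.alpha5_nonneg` / `Hyp.invTau_pos` (the §1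
clauses in the shapes the (2.18)–(2.25) theorems consume).

## HONEST SCOPE
Nothing of [II] is proved here beyond real arithmetic and bookkeeping; (2.16), the analyticity statement and the constants
clauses are NOT proved (hypothesis slots); the residual sentences are typed in the schematic currency of the existing
carrier (`StepData.Analytic` is an abstract predicate, kernels are abstract families over explicit index types), not on a
lattice carrier — the tree's torus-model theorems cited above are where the located content lives; no summit statement is
proved by this seat; count-neutral; nothing continuum ∕ ℝ⁴ ∕ OS ∕ mass-gap ∕ Clay.  No `sorry`, no `instance`, no `notation`.
-/

noncomputable section

namespace Literature.MathematicalPhysics.QuantumFieldTheory.Balaban1983to89.B13Carve29Sect2ClusterHyp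

open B13Resummation (Geometry SpRestr Repr213)

/-! ## §1  Residual printed sentences of pp. 14–17 (hypothesis form) -/

/-- **p. 14, ll. 10–11 [PDF 14]** (`p0014.txt:L10–L11`), verbatim: «This is the desired expansion into localized quantities.
The function H(Z) is localized in the interior of Z with respect to the external gauge fields.»  TYPED over the step carrier
(`S.H Z` = the activity H(Z) of (2.9) as a function of the configurations (𝐔, 𝐉, B), `B13.StepData`) BY NAME as the tree's
local-dependence predicate `LocExpansion.LocalDependence` ([Balaban1987RG1] p. 257) of the localized expansion `Z ↦ H(Z)`
over 𝐃_{k+1}, through the explicit carrier `agreeInt Z φ ψ` = «φ and ψ have the same external gauge fields on the interior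
of Z». [cite: Balaban1988RG2Cluster, p.14 ll.10–11 (after (2.9))] -/
def HLocalizedPrinted (S : B13.StepData) (agreeInt : S.Dk1.Dom → S.Φ → S.Φ → Prop) : Prop :=
  LocExpansion.LocalDependence (⟨S.Dk1, S.H⟩ : LocExpansion S.Φ) agreeInt

/-- Unfolding (definitional): H(Z) takes equal values on configurations with the same external gauge fields on the interior
of Z. [cite: Balaban1988RG2Cluster, p.14 ll.10–11] -/
theorem hLocalized_iff (S : B13.StepData) (agreeInt : S.Dk1.Dom → S.Φ → S.Φ → Prop) :
    HLocalizedPrinted S agreeInt ↔ ∀ Z φ ψ, agreeInt Z φ ψ → S.H Z φ = S.H Z ψ :=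
  Iff.rfl

/-- With (2.10) (`B13Factor210.Hsum_union`): a product of localized activities is localized — if H(Z₁), H(Z₂) are unchanged
by a modification of the configuration then so is H(Z₁)H(Z₂).  Bookkeeping. [cite: Balaban1988RG2Cluster, (2.10) p.14] -/
theorem hLocalized_mul {S : B13.StepData} {agreeInt : S.Dk1.Dom → S.Φ → S.Φ → Prop} (h : HLocalizedPrinted S agreeInt)
    {Z₁ Z₂ : S.Dk1.Dom} {φ ψ : S.Φ} (h₁ : agreeInt Z₁ φ ψ) (h₂ : agreeInt Z₂ φ ψ) :
    S.H Z₁ φ * S.H Z₂ φ = S.H Z₁ ψ * S.H Z₂ ψ := by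
  have e₁ : S.H Z₁ φ = S.H Z₁ ψ := h Z₁ φ ψ h₁
  have e₂ : S.H Z₂ φ = S.H Z₂ ψ := h Z₂ φ ψ h₂
  rw [e₁, e₂]

/-- **p. 15, ll. 2–6 [PDF 15]** (`p0015.txt:L2–L6`), verbatim: «The subfamily 𝐃 is important for the analyticity properties,
because it determines the potentials 𝐕_k(Y, B). They can be extended to functions of (𝐔, 𝐉), analytic on the space
Uᶜ_{k+1}(Y, (1 + β)α₀, (1 + β)α₁, α₀). Of course Y ⊂ Z₀, and Z̃₀ ⊂ Z ⊂ X for the activities in (2.13). The potentials are also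
analytic functions on the subspace Uᶜ_{k+1}(X, α₀, α₁).»  The first two sentences are Lemma 2 (`B13.Lemma2Printed`, analyticity
on `S.sp1 Y` = the space (1.34)); TYPED here is the LAST sentence, over the step carrier: for every X ∈ 𝐃_{k+1} and every
Y ∈ 𝐃_k inside it (explicit carrier `subk Y X` = «Y ⊂ X» across the two scales) the potential `S.V Y` = 𝐕_k(Y, ·) is analytic
(`S.Analytic`, the carrier's reader-owned predicate) on `S.sp2 X` = Uᶜ_{k+1}(X, α₀, α₁). [cite: Balaban1988RG2Cluster, p.15 ll.2–6] -/
def PotentialsRestrictPrinted (S : B13.StepData) (subk : S.Dk.Dom → S.Dk1.Dom → Prop) : Prop :=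
  ∀ X Y, subk Y X → S.Analytic (S.V Y) (S.sp2 X)

/-- **p. 15, ll. 9–11 [PDF 15]** (`p0015.txt:L9–L11`), verbatim: «Thus the activities in (2.13), and the whole sum E^{(k+1)}(X),
are analytic functions of (𝐔, 𝐉), on the space Uᶜ_{k+1}(X, α₀, α₁). This is the analyticity statement in the inductive
assumptions.»  TYPED over the step carrier: for every X ∈ 𝐃_{k+1}, every activity `S.H Z` with Z ⊂ X (explicit carrier `sub Z X`;
at the polymer geometry `G` of `B13Resummation` it is `G.cubes Z ⊆ G.cubes X`, as in `B13Resummation.SpRestr`) and the sum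
`S.Ek1 X` = E^{(k+1)}(X) of (2.13) are analytic on `S.sp2 X` = Uᶜ_{k+1}(X, α₀, α₁).  (The tree consumed the conclusion only as
the bare hypothesis `han` of `B13.deliverables_of_chain`, for `StepData.Etot = Ek1 + Elog`.) [cite: Balaban1988RG2Cluster, p.15 ll.9–11] -/
def Analytic213Printed (S : B13.StepData) (sub : S.Dk1.Dom → S.Dk1.Dom → Prop) : Prop :=
  (∀ X Z, sub Z X → S.Analytic (S.H Z) (S.sp2 X)) ∧ ∀ X, S.Analytic (S.Ek1 X) (S.sp2 X)

/-- The activity clause of the p. 15 statement. [cite: Balaban1988RG2Cluster, p.15 ll.9–11] -/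
theorem Analytic213Printed.activity {S : B13.StepData} {sub : S.Dk1.Dom → S.Dk1.Dom → Prop}
    (h : Analytic213Printed S sub) {X Z : S.Dk1.Dom} (hZX : sub Z X) : S.Analytic (S.H Z) (S.sp2 X) :=
  h.1 X Z hZX

/-- The E^{(k+1)}(X) clause of the p. 15 statement — the shape of the hypothesis `han` of `B13.deliverables_of_chain` for the
`Ek1`-summand of `StepData.Etot`. [cite: Balaban1988RG2Cluster, p.15 ll.9–11] -/
theorem Analytic213Printed.sum {S : B13.StepData} {sub : S.Dk1.Dom → S.Dk1.Dom → Prop} (h : Analytic213Printed S sub)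
    (X : S.Dk1.Dom) : S.Analytic (S.Ek1 X) (S.sp2 X) :=
  h.2 X

/-- At a reflexive inclusion relation every activity H(X) is analytic on its own space Uᶜ_{k+1}(X, α₀, α₁) (for `G.cubes X ⊆
G.cubes X` this is `subset_rfl`). [cite: Balaban1988RG2Cluster, p.15 ll.9–11] -/
theorem Analytic213Printed.activity_self {S : B13.StepData} {sub : S.Dk1.Dom → S.Dk1.Dom → Prop}
    (h : Analytic213Printed S sub) (hrefl : ∀ X, sub X X) (X : S.Dk1.Dom) : S.Analytic (S.H X) (S.sp2 X) :=
  h.1 X X (hrefl X)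

/-- **(2.16), p. 16 [PDF 16]** (`p0016.txt:L2–L3`, render `…-p016-x2.png`), verbatim: «For the quadratic form in the first
exponential the difference is a quadratic form ½⟨X, R₁X⟩, with matrix elements satisfying the bound
|R₁(b, b′)| ≦ (O(1)e^{−1/3δ₀M} + O(α₀ + α₁)) exp(−½δ₀|b₋ − b′₋|). (2.16)» and p. 16 ll. 9–13: «multiplied … by the function
exp½⟨B, R₂B⟩ with R₂ satisfying (2.16). In the second exponential the difference between the new bilinear form and the form in
(2.15) is a bilinear from −⟨B, R₃X⟩ with R₃ satisfying (2.16).»  TYPED — the display for ONE kernel family over explicit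
carriers: `ι` = the instances on which the kernel depends (Z₀, Z, the parameters σ(Z), the configuration (𝐔, 𝐉) in the space
of p. 15), `Bnd` = the bonds of T₁^{(k)}, `dist b b′` = |b₋ − b′₋|, `A₁`, `A₂` = the printed O(1) and the constant of O(α₀ + α₁),
`R i b b′` = the matrix element; `δ₀`, `M`, `α₀`, `α₁` from the constants record `B13.Consts`.  By assertion in print (cell
GAPS.md G-B13-07); on the torus model the tree DERIVES it for R₁ from primitive kernel bounds
(`B13Eq216FirstForm.h216R1_uniform`, inputs `B13PrimitiveKernels216.Differences216`). [cite: Balaban1988RG2Cluster, (2.16) p.16] -/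
def Bound216Printed (c : B13.Consts) {ι Bnd : Type*} (A₁ A₂ : ℝ) (dist : Bnd → Bnd → ℝ) (R : ι → Bnd → Bnd → ℂ) : Prop :=
  ∀ i b b', ‖R i b b'‖ ≤
    (A₁ * Real.exp (-(1 / 3 : ℝ) * c.δ₀ * c.M) + A₂ * (c.α₀ + c.α₁)) * Real.exp (-(1 / 2 : ℝ) * c.δ₀ * dist b b')

/-- The diagonal of a kernel satisfying (2.16): at `|b₋ − b₋| = 0` the matrix element is bounded by the printed coefficient
`O(1)e^{−1/3δ₀M} + O(α₀ + α₁)` — the first summand of α₅ (2.23). [cite: Balaban1988RG2Cluster, (2.16) p.16, (2.23) p.17] -/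
theorem Bound216Printed.norm_diag_le {c : B13.Consts} {ι Bnd : Type*} {A₁ A₂ : ℝ} {dist : Bnd → Bnd → ℝ}
    {R : ι → Bnd → Bnd → ℂ} (h : Bound216Printed c A₁ A₂ dist R) (hdist : ∀ b, dist b b = 0) (i : ι) (b : Bnd) :
    ‖R i b b‖ ≤ A₁ * Real.exp (-(1 / 3 : ℝ) * c.δ₀ * c.M) + A₂ * (c.α₀ + c.α₁) := by
  have := h i b b
  rwa [hdist b, mul_zero, Real.exp_zero, mul_one] at this

/-- A kernel satisfying (2.16) satisfies it with any larger constants (monotonicity used silently when the three kernels R₁,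
R₂, R₃ are given «satisfying (2.16)» with one pair of O(·)'s). [cite: Balaban1988RG2Cluster, (2.16) p.16] -/
theorem Bound216Printed.mono {c : B13.Consts} {ι Bnd : Type*} {A₁ A₂ A₁' A₂' : ℝ} {dist : Bnd → Bnd → ℝ}
    {R : ι → Bnd → Bnd → ℂ} (h : Bound216Printed c A₁ A₂ dist R) (h₁ : A₁ ≤ A₁') (h₂ : A₂ ≤ A₂')
    (hα : 0 ≤ c.α₀ + c.α₁) : Bound216Printed c A₁' A₂' dist R := by
  intro i b b'
  refine (h i b b').trans (mul_le_mul_of_nonneg_right ?_ (Real.exp_nonneg _))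
  have hE : 0 ≤ Real.exp (-(1 / 3 : ℝ) * c.δ₀ * c.M) := Real.exp_nonneg _
  nlinarith [mul_le_mul_of_nonneg_right h₁ hE, mul_le_mul_of_nonneg_right h₂ hα]

/-- **p. 16, ll. 4–5 [PDF 16]** (`p0016.txt:L4–L5`, render `…-p016-x2.png`), verbatim: «We have assumed, as in Sect. 1, that M
is much bigger than κ₁, especially that e^{−1/3δ₀M}e^{16κ₁} < 1.»  TYPED over the constants record (cell census R11; `δ₀` =
the decay rate of the propagators (1.18), `κ₁` of (1.21)). [cite: Balaban1988RG2Cluster, p.16 ll.4–5 (after (2.16))] -/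
def Restr216MPrinted (c : B13.Consts) : Prop :=
  Real.exp (-(1 / 3 : ℝ) * c.δ₀ * c.M) * Real.exp (16 * c.κ₁) < 1

/-- «M is much bigger than κ₁»: the printed inequality is `16κ₁ < ⅓δ₀M` (so `M > 48κ₁/δ₀`).  Real arithmetic.
[cite: Balaban1988RG2Cluster, p.16 ll.4–5] -/
theorem restr216M_iff (c : B13.Consts) : Restr216MPrinted c ↔ 16 * c.κ₁ < (1 / 3 : ℝ) * c.δ₀ * c.M := by
  unfold Restr216MPrinted
  rw [← Real.exp_add, ← Real.exp_zero, Real.exp_lt_exp]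
  constructor <;> intro h <;> linarith

/-- Under the p. 16 restriction the first summand `e^{−1/3δ₀M}` of the (2.16)/(2.17)/(2.23) coefficients is below `e^{−16κ₁}`.
[cite: Balaban1988RG2Cluster, p.16 ll.4–5, (2.16)–(2.17) p.16] -/
theorem exp_third_lt_of_restr216M {c : B13.Consts} (h : Restr216MPrinted c) :
    Real.exp (-(1 / 3 : ℝ) * c.δ₀ * c.M) < Real.exp (-(16 * c.κ₁)) := by
  rw [restr216M_iff] at h
  exact Real.exp_lt_exp.mpr (by linarith)

/-- **p. 16 [PDF 16]**, two constants clauses, verbatim: ll. 13–14 (`p0016.txt:L13–L14`, before (2.18)) «We take a small,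
positive number α₄, to be chosen later, and» (2.18); last line (`p0016.txt:L33`, after (2.22)) «where γ₂ is a small, positive
constant.»  TYPED over the constants record: the
POSITIVITY of α₄ and γ₂ («small» is effected by the later printed restrictions — `B13.Consts.R15`, `R16`, the (2.31) threshold,
`B13Lemma3TorusSocket.Lemma3Numerics` — which are cited, not restated). [cite: Balaban1988RG2Cluster, p.16 (before (2.18)) and p.16 (after (2.22))] -/
def SmallPositive16Printed (c : B13.Consts) : Prop :=
  0 < c.α₄ ∧ 0 < c.γ₂

/-- γ₂ ≥ 0 — the hypothesis `hγ` of the tree's certification `B13.indicator_le_exp_222` of (2.22). [cite: Balaban1988RG2Cluster, (2.22) p.16] -/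
theorem SmallPositive16Printed.indicator222 {c : B13.Consts} (h : SmallPositive16Printed c) (x r : ℝ) (hr : 0 ≤ r) :
    (if r ≤ |x| then (1 : ℝ) else 0) ≤ Real.exp (c.γ₂ / 2 * (x ^ 2 - r ^ 2)) :=
  B13.indicator_le_exp_222 x r c.γ₂ h.2.le hr

/-- α₄ > 0 — with positive E₀, ε₁, C₁, M the quantity `1/|τ(Y)|` of (2.18) is positive (`B13Bound143.invTau_pos`).
[cite: Balaban1988RG2Cluster, (2.18) p.16] -/
theorem SmallPositive16Printed.invTau_pos {c : B13.Consts} (h : SmallPositive16Printed c) (hE : 0 < c.E₀) (hε : 0 < c.ε₁)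
    (hC₁ : 0 < c.C₁) (hM : 0 < c.M) (d : ℝ) : 0 < B13Bound143.invTau c d :=
  B13Bound143.invTau_pos c hE hε hC₁ h.1 hM d

/-- **p. 17, l. 5 [PDF 17]** (`p0017.txt:L5`, render `…-p017-x2.png`), verbatim (after (2.23)): «where α₅ = O(1)e^{−1/3δ₀M} +
O(α₀ + α₁) + O(1)α₄ + γ₂.»  TYPED over the constants record, whose field `α₅` is otherwise free: the three printed O(·)'s as
explicit carriers `O₁`, `O₂`, `O₃`. [cite: Balaban1988RG2Cluster, p.17 l.5 (after (2.23))] -/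
def Alpha5Printed (c : B13.Consts) (O₁ O₂ O₃ : ℝ) : Prop :=
  c.α₅ = O₁ * Real.exp (-(1 / 3 : ℝ) * c.δ₀ * c.M) + O₂ * (c.α₀ + c.α₁) + O₃ * c.α₄ + c.γ₂

/-- With non-negative O(·)'s and non-negative α₀ + α₁, α₄, γ₂ the printed α₅ is non-negative — the hypothesis `0 ≤ a` of the
(2.25) theorems `B13Integral223.outer_225_le`, `integral223_le_226`. [cite: Balaban1988RG2Cluster, p.17 l.5, (2.25) p.17] -/
theorem Alpha5Printed.nonneg {c : B13.Consts} {O₁ O₂ O₃ : ℝ} (h : Alpha5Printed c O₁ O₂ O₃) (hO₁ : 0 ≤ O₁) (hO₂ : 0 ≤ O₂)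
    (hO₃ : 0 ≤ O₃) (hα : 0 ≤ c.α₀ + c.α₁) (hα₄ : 0 ≤ c.α₄) (hγ₂ : 0 ≤ c.γ₂) : 0 ≤ c.α₅ := by
  rw [h]
  have hE : 0 ≤ Real.exp (-(1 / 3 : ℝ) * c.δ₀ * c.M) := Real.exp_nonneg _
  positivity

/-- The printed α₅ dominates γ₂ (non-negative O(·)'s, α's): the (2.22) rate is absorbed into α₅ in (2.23).
[cite: Balaban1988RG2Cluster, p.17 l.5, (2.22)–(2.23) pp.16–17] -/
theorem Alpha5Printed.gamma2_le {c : B13.Consts} {O₁ O₂ O₃ : ℝ} (h : Alpha5Printed c O₁ O₂ O₃) (hO₁ : 0 ≤ O₁) (hO₂ : 0 ≤ O₂)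
    (hO₃ : 0 ≤ O₃) (hα : 0 ≤ c.α₀ + c.α₁) (hα₄ : 0 ≤ c.α₄) : c.γ₂ ≤ c.α₅ := by
  rw [h]
  have hE : 0 ≤ Real.exp (-(1 / 3 : ℝ) * c.δ₀ * c.M) := Real.exp_nonneg _
  nlinarith [mul_nonneg hO₁ hE, mul_nonneg hO₂ hα, mul_nonneg hO₃ hα₄]

/-- **p. 17, l. 12 [PDF 17]** (`p0017.txt:L12`, render `…-p017-x2.png`; the «½» is a stacked glyph the text layer garbles),
verbatim (after (2.24)): «Of course we have assumed that α₅ is sufficiently small, e.g. α₅‖C^{(k)}(Z₀, 0)‖ < ½.»  TYPED over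
the constants record with the explicit carrier `normC` = ‖C^{(k)}(Z₀, 0)‖, the operator norm of the covariance conditioned on
the domain Z₀ at hand (cell census R14; the tower consumes it located as the binder `hαc`, `B13Bound226Numerals`).
[cite: Balaban1988RG2Cluster, p.17 l.12 (after (2.24))] -/
def Restr224Printed (c : B13.Consts) (normC : ℝ) : Prop :=
  c.α₅ * normC < 1 / 2

/-- The weak form `α₅‖C‖ ≤ ½`. [cite: Balaban1988RG2Cluster, p.17 l.12] -/
theorem Restr224Printed.le_half {c : B13.Consts} {normC : ℝ} (h : Restr224Printed c normC) : c.α₅ * normC ≤ 1 / 2 :=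
  le_of_lt h

/-- What the clause buys (p. 17): `α₅‖C^{(k)}(Z₀, 0)‖ < 1`, the hypothesis `hαc` of `B13Integral223.posDef_inv_sub_smul` making
the precision `C^{(k)}(Z₀, 0)⁻¹ − α₅I` of the B-integral (2.24) positive definite. [cite: Balaban1988RG2Cluster, (2.24) p.17] -/
theorem Restr224Printed.lt_one {c : B13.Consts} {normC : ℝ} (h : Restr224Printed c normC) : c.α₅ * normC < 1 :=
  lt_of_lt_of_le h (by norm_num)

/-- For a positive definite `C^{(k)}(Z₀, 0)` with spectrum below `normC`, the p. 17 clause gives the positive definiteness of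
`C^{(k)}(Z₀, 0)⁻¹ − α₅I` ((2.24) is a convergent Gaussian integral) — BY NAME from `B13Integral223.posDef_inv_sub_smul` is
not imported here (matrix carrier); this is its scalar core: every `1 − α₅λ`, `0 < λ ≤ normC`, is positive.
[cite: Balaban1988RG2Cluster, (2.24) p.17] -/
theorem Restr224Printed.one_sub_mul_pos {c : B13.Consts} {normC : ℝ} (h : Restr224Printed c normC) (hα : 0 ≤ c.α₅)
    {ev : ℝ} (hev : ev ≤ normC) : 0 < 1 - c.α₅ * ev := by
  have h1 : c.α₅ * ev ≤ c.α₅ * normC := mul_le_mul_of_nonneg_left hev hα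
  have h2 := h.lt_one
  linarith

/-! ## §2  The bundle: the printed statements of pp. 11–17 as hypotheses, by name -/

/-- **Carriers of the block-29 bundle** beyond the step carrier `S : B13.StepData` (which already carries 𝐃_k, 𝐃_{k+1}, the
configurations `Φ`, the spaces `sp1` (1.34) and `sp2` (p. 15), the potentials `V`, the activity `H` (2.9), the sum `Ek1` (2.13),
the reader-owned predicates `Analytic`, `GaugeInv`), the constants record `c : B13.Consts` and the polymer geometry `G` of 𝐃_{k+1}
(`B13Resummation.Geometry`: cube footprints, the hard core ζ of (2.11)) — one field per parameter of the block's other printed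
statements, plain data: p. 14 — `agreeInt Z φ ψ` («same external gauge fields on the interior of Z»); p. 15 — `subk Y X` (Y ∈ 𝐃_k
inside X ∈ 𝐃_{k+1}); (2.16) — the instances `ι216` of the three replacement kernels (Z₀, Z, σ(Z), (𝐔, 𝐉)), the bonds `Bnd` of
T₁^{(k)} with `dist b b′` = |b₋ − b′₋|, the kernels `R₁`, `R₂`, `R₃` and the printed O(·)'s `A₁`, `A₂`; p. 17 — the O(·)'s `O₁`,
`O₂`, `O₃` of α₅ and `normC Z₀` = ‖C^{(k)}(Z₀, 0)‖ for Z₀ ∈ 𝐃_k. [cite: Balaban1988RG2Cluster, (2.9)–(2.26) pp.14–17] -/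
structure Carriers (S : B13.StepData) where
  agreeInt : S.Dk1.Dom → S.Φ → S.Φ → Prop
  subk : S.Dk.Dom → S.Dk1.Dom → Prop
  ι216 : Type
  Bnd : Type
  dist : Bnd → Bnd → ℝ
  R₁ : ι216 → Bnd → Bnd → ℂ
  R₂ : ι216 → Bnd → Bnd → ℂ
  R₃ : ι216 → Bnd → Bnd → ℂ
  A₁ : ℝ
  A₂ : ℝ
  O₁ : ℝ
  O₂ : ℝ
  O₃ : ℝ
  normC : S.Dk.Dom → ℝ

/-- **BLOCK 29 BUNDLE — the printed statements of [Balaban1988RG2Cluster] pp. 11–17 AS HYPOTHESES, BY NAME.**  One field per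
statement, each a reference to the declaration typing it (nothing restated): `loc214` — p. 14 «The function H(Z) is localized in
the interior of Z with respect to the external gauge fields» (`HLocalizedPrinted`); `repr213` — (2.13) p. 14 «E^{(k+1)}(X) =
Σ_{n=1}^∞ (1/n!) Σ_{(Z₁,…,Z_n): ∪Z_i = X} ρ^T(Z₁,…,Z_n)H(Z₁)⋯H(Z_n)» (`B13Resummation.Repr213`, Kotecký–Preiss form); `spRestr` —
p. 15 «Z̃₀ ⊂ Z ⊂ X for the activities in (2.13) … therefore we can restrict them, as analytic functions, to the above subspace»
(`B13Resummation.SpRestr`); `potentials` — p. 15 «The potentials are also analytic functions on the subspace Uᶜ_{k+1}(X, α₀, α₁)»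
(`PotentialsRestrictPrinted`); `analytic` — p. 15 «Thus the activities in (2.13), and the whole sum E^{(k+1)}(X), are analytic
functions of (𝐔, 𝐉), on the space Uᶜ_{k+1}(X, α₀, α₁)» (`Analytic213Printed` at `G.cubes Z ⊆ G.cubes X`); `b216` — (2.16) p. 16
for the three kernels R₁, R₂, R₃ (`Bound216Printed`); `r11` — p. 16 «e^{−1/3δ₀M}e^{16κ₁} < 1» (`Restr216MPrinted`); `r12` — p. 16
«We assume that ⅛(κ₁ − 1) ≧ (1 − 3δ)κ, C₃ ≦ E₀C₁, and q ≧ 8» (`B13Bound143.R12`, verbatim there); `pos16` — p. 16 «a small,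
positive number α₄ … γ₂ is a small, positive constant» (`SmallPositive16Printed`); `alpha5` — p. 17 «α₅ = O(1)e^{−1/3δ₀M} + O(α₀ +
α₁) + O(1)α₄ + γ₂» (`Alpha5Printed`); `r14` — p. 17 «α₅‖C^{(k)}(Z₀, 0)‖ < ½» for every Z₀ ∈ 𝐃_k (`Restr224Printed`).  Hypothesis
slots only; the PROVED displays (2.1), (2.3), (2.5)–(2.11), (2.14)–(2.15), (2.17)–(2.26) are theorems of the tree (module
docstring) and enter nothing. [cite: Balaban1988RG2Cluster, (2.9)–(2.13) p.14, p.15, (2.16)–(2.22) p.16, (2.23)–(2.24) p.17] -/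
structure Hyp (S : B13.StepData) (c : B13.Consts) {Cube : Type} [DecidableEq Cube] (G : Geometry S.Dk1 Cube)
    (X : Carriers S) : Prop where
  loc214 : HLocalizedPrinted S X.agreeInt
  repr213 : Repr213 S G
  spRestr : SpRestr S G
  potentials : PotentialsRestrictPrinted S X.subk
  analytic : Analytic213Printed S (fun Z Y => G.cubes Z ⊆ G.cubes Y)
  b216 : Bound216Printed c X.A₁ X.A₂ X.dist X.R₁ ∧ Bound216Printed c X.A₁ X.A₂ X.dist X.R₂ ∧
    Bound216Printed c X.A₁ X.A₂ X.dist X.R₃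
  r11 : Restr216MPrinted c
  r12 : B13Bound143.R12 c
  pos16 : SmallPositive16Printed c
  alpha5 : Alpha5Printed c X.O₁ X.O₂ X.O₃
  r14 : ∀ Z₀ : S.Dk.Dom, Restr224Printed c (X.normC Z₀)

variable {S : B13.StepData} {c : B13.Consts} {Cube : Type} [DecidableEq Cube] {G : Geometry S.Dk1 Cube} {X : Carriers S}

/-- **The consumer's road, first junction.**  The bundle's `spRestr` (p. 15) and `repr213` ((2.13)) ARE the two structural
inputs of the tree's kernel discharge of the [26]-step (2.38) ⇒ (2.41) (`B13Resummation.cammarotaStep_of_KP`, Kotecký–Preiss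
engine); the remaining inputs are the printed «κ sufficiently large, ε₁ sufficiently small» of p. 21 and the O(1) =: A₂.
Bookkeeping, by name. [cite: Balaban1988RG2Cluster, (2.13) p.14, p.15, (2.39)–(2.41) p.21] -/
theorem Hyp.cammarotaStep (h : Hyp S c G X) (hA : 0 ≤ c.C3act * c.ε₁)
    (hr₁ : 0 ≤ (1 - 10 * c.δ) * ((c.L : ℝ) / 2) * c.κ)
    (hlarge : (1 - 10 * c.δ) * ((c.L : ℝ) / 2) * c.κ + 2 * G.κ₀ + 2 ≤ (1 - 8 * c.δ) * ((c.L : ℝ) / 2) * c.κ)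
    (hsmall : c.C3act * c.ε₁ * Real.exp (5 * ((1 - 10 * c.δ) * ((c.L : ℝ) / 2) * c.κ) + 1) *
      G.K₀ * G.ν * G.c₁ ≤ 1)
    (hA₂ : Real.exp 1 * G.ν * G.c₁ * G.K₀ ^ 2 ≤ c.A₂) : B13.CammarotaStep S c :=
  B13Resummation.cammarotaStep_of_KP S c G h.spRestr h.repr213 hA hr₁ hlarge hsmall hA₂

/-- **The consumer's road, to the leaf's clauses.**  With Lemma 3 (`B13.Lemma3Printed`, block 30 / the DAG leaf), the p. 21
closing restrictions `R22`, `R23`, `R24`, the log Z^{(k)} half, the representation (I.1.7) and gauge invariance (pp. 21–22) —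
all BY NAME as in `B13.deliverables_of_chain` — the bundle supplies the [26]-step (`Hyp.cammarotaStep`) and the analyticity of
the total `Etot = Ek1 + Elog` is the printed p. 15 statement for `Ek1` (`h.analytic.sum`) plus the log-half's (hypothesis
`hanlog`, reader-owned additivity `hadd` of the abstract predicate).  Bookkeeping. [cite: Balaban1988RG2Cluster, p.15 ll.9–11 and pp.20–22 (Lemma 3 to Thm I.3)] -/
theorem Hyp.deliverables (h : Hyp S c G X) (hR : S.Restr) (h3 : B13.Lemma3Printed S c)
    (hA : 0 ≤ c.C3act * c.ε₁) (hr₁ : 0 ≤ (1 - 10 * c.δ) * ((c.L : ℝ) / 2) * c.κ)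
    (hlarge : (1 - 10 * c.δ) * ((c.L : ℝ) / 2) * c.κ + 2 * G.κ₀ + 2 ≤ (1 - 8 * c.δ) * ((c.L : ℝ) / 2) * c.κ)
    (hsmall : c.C3act * c.ε₁ * Real.exp (5 * ((1 - 10 * c.δ) * ((c.L : ℝ) / 2) * c.κ) + 1) *
      G.K₀ * G.ν * G.c₁ ≤ 1)
    (hA₂ : Real.exp 1 * G.ν * G.c₁ * G.K₀ ^ 2 ≤ c.A₂)
    (h22 : c.R22) (h23 : c.R23) (h24 : c.R24) (hE₀ : 0 ≤ c.E₀)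
    (hlog : B13.Bound118 S.Dk1 S.sp2 S.Elog (c.E₀ / 2) (c.δ₀ * c.M)) (hrepr : S.Repr17)
    (hanlog : ∀ Y, S.Analytic (S.Elog Y) (S.sp2 Y))
    (hadd : ∀ Y, S.Analytic (S.Ek1 Y) (S.sp2 Y) → S.Analytic (S.Elog Y) (S.sp2 Y) → S.Analytic (S.Etot Y) (S.sp2 Y))
    (hg : ∀ Y, S.GaugeInv (S.Etot Y)) : B13.Deliverables S c :=
  B13.deliverables_of_chain S c hR h3 (h.cammarotaStep hA hr₁ hlarge hsmall hA₂) h22 h23 h24 hE₀ hlog hrepr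
    (fun Y => hadd Y (h.analytic.sum Y) (hanlog Y)) hg

/-- Every activity H(Z) is analytic on its own space Uᶜ_{k+1}(Z, α₀, α₁) (the p. 15 statement at Z ⊂ Z). [cite: Balaban1988RG2Cluster, p.15 ll.9–11] -/
theorem Hyp.activity_analytic (h : Hyp S c G X) (Z : S.Dk1.Dom) : S.Analytic (S.H Z) (S.sp2 Z) :=
  h.analytic.activity_self (fun _ => subset_rfl) Z

/-- The (2.18) rate clause of p. 16 out of the bundle (`B13Bound143.R12`, first clause): `(1 − 3δ)κ ≤ ⅛(κ₁ − 1)`.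
[cite: Balaban1988RG2Cluster, p.16 (after (2.18))] -/
theorem Hyp.rate218 (h : Hyp S c G X) : (1 - 3 * c.δ) * c.κ ≤ (c.κ₁ - 1) / 8 :=
  h.r12.1

/-- α₅ ≥ 0 out of the bundle, for non-negative printed O(·)'s and α₀ + α₁ ≥ 0 (the sign input of the (2.25)/(2.26) theorems
`B13Integral223.outer_225_le`, `integral223_le_226`). [cite: Balaban1988RG2Cluster, p.17 l.5, (2.25) p.17] -/
theorem Hyp.alpha5_nonneg (h : Hyp S c G X) (hO₁ : 0 ≤ X.O₁) (hO₂ : 0 ≤ X.O₂) (hO₃ : 0 ≤ X.O₃)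
    (hα : 0 ≤ c.α₀ + c.α₁) : 0 ≤ c.α₅ :=
  h.alpha5.nonneg hO₁ hO₂ hO₃ hα h.pos16.1.le h.pos16.2.le

/-- The (2.24) precision is positive at every Z₀: for eigenvalues `0 < λ ≤ ‖C^{(k)}(Z₀, 0)‖` one has `1 − α₅λ > 0` (p. 17 clause
+ α₅ ≥ 0). [cite: Balaban1988RG2Cluster, (2.24) p.17] -/
theorem Hyp.posDef224 (h : Hyp S c G X) (hO₁ : 0 ≤ X.O₁) (hO₂ : 0 ≤ X.O₂) (hO₃ : 0 ≤ X.O₃) (hα : 0 ≤ c.α₀ + c.α₁)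
    (Z₀ : S.Dk.Dom) {ev : ℝ} (hev : ev ≤ X.normC Z₀) : 0 < 1 - c.α₅ * ev :=
  (h.r14 Z₀).one_sub_mul_pos (h.alpha5_nonneg hO₁ hO₂ hO₃ hα) hev

/-- `1/|τ(Y)| > 0` out of the bundle (α₄ > 0) for positive E₀, ε₁, C₁, M — the (2.18) weights of (2.26) are positive.
[cite: Balaban1988RG2Cluster, (2.18) p.16, (2.26) p.17] -/
theorem Hyp.invTau_pos (h : Hyp S c G X) (hE : 0 < c.E₀) (hε : 0 < c.ε₁) (hC₁ : 0 < c.C₁) (hM : 0 < c.M) (d : ℝ) :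
    0 < B13Bound143.invTau c d :=
  h.pos16.invTau_pos hE hε hC₁ hM d

/-- The first summand of the (2.16) coefficient is below `e^{−16κ₁}` out of the bundle (p. 16 «M is much bigger than κ₁»), so the
diagonal of each replacement kernel is `< O(1)e^{−16κ₁} + O(α₀ + α₁)` when O(1) > 0. [cite: Balaban1988RG2Cluster, (2.16) p.16 and p.16 ll.4–5] -/
theorem Hyp.diag216_lt (h : Hyp S c G X) (hdist : ∀ b, X.dist b b = 0) (hA₁ : 0 < X.A₁) (i : X.ι216) (b : X.Bnd) :
    ‖X.R₁ i b b‖ < X.A₁ * Real.exp (-(16 * c.κ₁)) + X.A₂ * (c.α₀ + c.α₁) := by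
  have h1 := h.b216.1.norm_diag_le hdist i b
  have h2 := mul_lt_mul_of_pos_left (exp_third_lt_of_restr216M h.r11) hA₁
  linarith

end Literature.MathematicalPhysics.QuantumFieldTheory.Balaban1983to89.B13Carve29Sect2ClusterHyp

end
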